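import Mathlib
import HarnessLib
import HarnessLib.Audit
import Summits.PneNP.Statement
import Literature.Computability.Complexity.Circuit
import Literature.Computability.Complexity.Nondeterministic
import Literature.Computability.Complexity.CircuitClasses
import Literature.Computability.Complexity.NegationLimited
import Literature.Computability.Complexity.ClayProblem
import Literature.Computability.Complexity.NegationLimitedProofs
import Literature.Computability.Complexity.CircuitClassesUniformProofs
import Literature.Computability.Complexity.ClayProblemProofs
import Literature.Computability.Complexity.DeMorganSimulation
import Literature.Computability.Complexity.PerfectMatchingApproximators
import Literature.Barriers.PneNP.MonotoneGap
import HarnessLib.Audit.Status.Attr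

/-!
Route: NegLimited

# Route NegLimited — push the monotone method through ⌈log₂(n+1)⌉ NOT gates (extremal combinatorics)

Words: some NP language L needs superpolynomial-size De Morgan circuits (fan-in-2 ∧, ∨ and ¬)
whenever only
⌈log₂(n+1)⌉ negation gates are allowed: for every exponent k, for infinitely many n, every such
circuit computing
the slice L ∩ {0,1}ⁿ with at most ⌈log₂(n+1)⌉ NOT gates has more than n^k gates. ⌈log₂(n+1)⌉ is
Markov's border:
with that many negations and polynomial overhead (Fischer) every polynomial-size circuit is
simulated, so
X ⇔ NP ⊄ P/poly; the NOT budget b(n) ∈ [0, ⌈log₂(n+1)⌉] is the interpolation parameter between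
monotone lower
bounds (theorems) and general ones (the target), and the cruxes are the rungs b = ⌊ε·log₂ n⌋ (#2), b
= c·log₂ log₂ n
for every c (#3) and the truly exponential monotone fuel (#4).
Lean: `∃ L ∈ Literature.Computability.Complexity.Nondeterministic.NP, ∀ k : ℕ, ∃ᶠ n in Filter.atTop,
∀ C : Literature.Computability.Complexity.Circuit (Fin n), C.IsOver
Literature.Computability.Complexity.deMorganBasis → C.Computes (L.sliceFn n) → C.sizeWith (fun g =>
if g = Literature.Computability.Complexity.GateFn.not then 1 else 0) ≤ Nat.clog 2 (n + 1) → n ^ k <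
C.size`

## Assembly
`theorem closes (hX : NeglimitedThesis) : PneNP` is PROVED in the route file (route-repair
2026-08-15, ≈ 60 lines,
axioms propext / Classical.choice / Quot.sound): from ¬PneNP every Cook-NP language is Cook-P;
transport the thesis
language along the model bridges `Literature.Computability.Complexity.NP_bool_eq_holds`
(ClayProblemProofs) and
`Literature.Computability.Complexity.P_bool_eq_holds` (ClayProblem) into `Classes.P ⊆ PPoly`
(`Literature.Computability.Complexity.P_subset_PPoly_holds`, CircuitClassesUniformProofs;
AroraBarak2009 Thm 6.6), so
L has B₂-circuits of size ≤ p(n) deciding its slices (`CircuitFamily.Decides.eval_eq`); convert them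
to the De
Morgan basis (`Literature.Computability.Complexity.Circuit.exists_deMorgan_of_B2`,
DeMorganSimulation: size ≤ 12s+3,
needs n ≥ 1) and apply Fischer's theorem
(`Literature.Computability.Complexity.fischer_negationLimited_holds`,
NegationLimitedProofs; Fischer1975, Jukna2012 §10.4: ≤ ⌈log₂(n+1)⌉ NOT gates, size ≤ 2s + c(n⁴+1));
the total
2(12(c'n^k+c')+3) + c(n⁴+1) is ≤ n^(max k 4 + 1) for n ≥ 48c'+6+2c, contradicting X at that exponent
on one of its
infinitely many lengths (`Filter.Frequently.and_eventually`). Every fact used is a discharged tree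
theorem, so the
route's only open obligation towards PneNP is X itself; the former item `Assembly` (stmt-PneNP-0410:
`fischer_negationLimited → (B₂→De Morgan) → P_subset_PPoly → P_bool_eq → NP_bool_eq → P_subset_NP →
X → PneNP`,
which carried those facts as unlisted hypotheses) is restated as `NeglimitedThesis → PneNP` (rank 1,
provable now by
`fun hX => closes hX`), the gate not allowing an assembly item to be dropped.

How the cruxes relate to X (ladder logic): for a language with monotone non-constant slices a lower
bound against a
larger NOT budget implies the bound against every smaller one (admissible circuits exist by
`markov_upper`), so in
difficulty #3 ≤ #2 ≤ X, and #4 is the quantitative input the Amano–Maruoka 2^b-decomposition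
consumes at b = ε·log n;
none of #2–#4 is a hypothesis of `closes` — they are the milestones by which the line earns or loses
staffing. Both #2
and #3 are typed with `negLimitedSizeOver` (junk 0, so `n^k < …` forces an admissible circuit to
exist) after the
vacuity of the first `sizeWith`-quantified drafts below Markov's bound was PROVED from
`markov_lower`
(Summits/PneNP/PneNP/Theorems/NegLimitedVacuity.lean).

UNDER FLOOR: fewer than 2 cruxes remain after retriage (legacy route; D-0019).

Rationale: WHY THIS LINE. (widen: extremal set theory — sunflowers — and lifting from communication complexity)
Monotone circuit
lower bounds are the one place where superpolynomial size bounds for explicit NP functions are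
theorems: the
Razborov–Alon–Boppana bound for CLIQUE (tree fact
`Literature.Computability.Complexity.razborov_alon_boppana`
[Razborov1985; AlonBoppana1987]) up to exp(Ω(n^{1/2}/log n)) via robust sunflowers
[CavalarKumarRossman2022 =
arXiv:2012.03883, Thm 2.19], fed by the Alweiss–Lovett–Wu–Zhang bound [arXiv:1908.08483]. Markov's
theorem
(inversion complexity = ⌈log₂(d(f)+1)⌉ ≤ ⌈log₂(n+1)⌉; tree facts `markov_lower`/`markov_upper`, both
discharged) makes
"monotone + b(n) NOT gates" a complete interpolation: b = 0 is known, b = ⌈log₂(n+1)⌉ is NP ⊄ P/poly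
by Fischer's
polynomial-overhead simulation [Markov1958; Fischer1975; BealsNishinoTanaka1998; Jukna2012 §10]
(tree fact
`fischer_negationLimited`, discharged — this is exactly what the deciding theorem `closes` uses),
and the record for
unbounded-depth circuits is b = ⌊(1/6)·log₂ log₂ m⌋ for CLIQUE [AmanoMaruoka2005; tree fact
`amano_maruoka`]. The route
imports (i) sunflower / spread-lemma technology from extremal and probabilistic combinatorics (the
approximation
method's engine), (ii) query-to-communication lifting, which re-derives and strengthens monotone
bounds from
resolution width [GargEtAl2018; PitassiRobere2017], and (iii) the cryptographic reading of negations
— PRFs need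
log₂ n − O(1) NOT gates [GuoEtAl2015], circuits with t negations are learnable [BlaisEtAl2015] —
which says
natural-proofs pressure is absent strictly below the top rung. What it does that the routes circuit
/ Circuit
(X = NP ⊄ P/poly attacked by class or via MCSP) do not: it indexes progress by the number b(n), so
every partial
result is a theorem about an explicit NOT budget for an explicit monotone NP function.

RANKED CRUXES. #0 NeglimitedThesis (target) — Route thesis X: there is L ∈ NP such that for every k,
for infinitely many n, every circuit over {∧₂,∨₂,¬} computing L∩{0,1}ⁿ with at most ⌈log₂(n+1)⌉ NOT
gates has more than n^k gates (⇔ NP ⊄ P/poly by Markov–Fischer). (why it might fail: X ⇔ NP ⊄ P/poly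
(Fischer: ⌈log₂(n+1)⌉ NOTs cost ≤2t+O(n²log²n), fischer_negationLimited), so ¬X ⇔ NP ⊆ P/poly is
consistent with all known bounds; at this budget the class is all of P/poly, so NaturalProofs (RR97
Thm 4.1) and the monotone/negation gaps (Tardos1988; Jukna2004) bite in full.) [Jukna2012 §10.5 (PDF
p.310), Fischer1975, Markov1958, BealsNishinoTanaka1998, RazborovRudich1997, Tardos1988]
#2 NeglimitedEpsLogNegations (crux) — Rung ε·log n: some NP language and some fixed ε > 0 such that
for every k, for infinitely many n, the least size of a De Morgan circuit with ≤ ⌊ε·log₂ n⌋ NOT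
gates computing the slice exceeds n^k (negLimitedSizeOver; junk 0 forces such a circuit to exist).
[difficulty: open-problem] (why it might fail: r NOTs cost a 2^-r loss in both-direction monotone
inseparability (r-hard pairs, Jukna2012 Ex.9.7), so r=ε·log n needs n^-ε-correlation-type bounds for
poly-size monotone CIRCUITS of any depth—known only for mNC¹ (Rossman2015: (1/2−ε)log n NOTs);
circuits stuck at r≈(1/6)loglog n since 2005.) [AmanoMaruoka2005, Jukna2012 §9.9 (PDF pp.287-288, RP
9.29), §10.5 (PDF p.310), Rossman2015, CanonneEtAl2019 p.6,
Literature.Computability.Complexity.amano_maruoka, Literature.Barriers.PneNP.NegationLimitedGap]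
#3 NeglimitedAllCLoglogNegations (crux) — Rung c·log log n for every c: for every constant c some NP
language (depending on c) whose slices need superpolynomial De Morgan circuits when c·⌊log₂⌊log₂ n⌋⌋
NOT gates are allowed (removes the 1/6 of Amano–Maruoka). [difficulty: XL] (why it might fail: Known
only to r≈(1/6)loglog n via CLIQUE's r-hard pair (AmanoMaruoka2005; Jukna2012 p.288), unimproved for
unbounded-depth circuits (CanonneEtAl2019 p.6); 'every c' is a weak form of open RP 9.29 (r≫loglog
n); route names no new pair/NOT-charging step. c=0 needs CLIQUE∈CplxCore.NP (TM verifier).)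
[AmanoMaruoka2005, Jukna2012 §9.9 RP 9.29 (PDF p.288), §10.5 (PDF p.310), CanonneEtAl2019 p.6,
Razborov1985, AlonBoppana1987, Literature.Computability.Complexity.amano_maruoka]
#4 NeglimitedTrulyExponentialMonotone (crux) — Fuel: some NP language whose slices are eventually
non-constant monotone functions of monotone circuit complexity at least 2^{εn} for a fixed ε > 0.
[difficulty: open-problem] (why it might fail: 2^Ω(n) for explicit monotone f is open
(arXiv:2012.03883 p.3; record exp(Ω(√n/log n)), Thm 2.19); §2.8: spreadness+sunflower bounds
near-optimal, 'to get beyond 2^Ω(√n) another approach seems to be required'; 2^Ω(n) only for mon.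
formulas/span programs (PitassiRobere2017). ∀ᶠn: hard slice at each n.) [arXiv:2012.03883 p.3, Thm
2.19, §2.8 (p.9), arXiv:1908.08483 Thm 1.9, CavalarKumarRossman2022, PitassiRobere2017,
paper:w2950340987 (Robere 2018 thesis) pp.70-71, Problem 2, Razborov1985]

TWO-LAYER PLAN. Foreseen once a rung moves: NeglimitedEpsLogNegations ⇐ (an r-hard pair inside an NP
language for r = ε·log₂ n) → (r-hard pair at budget r ⇒ superpolynomial negLimitedSizeOver at budget
r) → NeglimitedEpsLogNegations (k = 2, glue = Jukna2012 Exercise 9.7); nothing filed now.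

KILL CRITERIA. ¬X ⇔ NP ⊆ P/poly: refutes this route together with circuit / Circuit (and collapses
PH by
`karp_lipton`, discharged), not the problem — close --reason refuted:NeglimitedThesis. A "negation
barrier" theorem
— a natural-proofs-style or gap-style obstruction showing that approximation-method / sunflower /
lifting arguments
for single-output monotone NP functions cannot pass b = O(log log n) (a single-output analogue of
Jukna2012 Thm 10.21
at that budget) — forces a pivot of #2 to non-approximation engines or closes the route as
exhausted. #4 refuted
(every NP language with monotone slices has 2^{o(n)} monotone circuits, or the ∀ᶠ-n form fails for
every candidate)
does not kill X but removes the fuel for #2: drop #4, re-rank #2 behind #3. #3 refuted for some c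
(every NP language
has, eventually, polynomial-size circuits with c·log log n negations or no admissible ones) retires
the whole ladder
below log log n: close --reason refuted:NeglimitedAllCLoglogNegations unless the refutation is by
junk values
(misstated ⇒ repaired item).

NOT DECOMPOSED YET. Which explicit function carries #2/#3 (CLIQUE at Amano–Maruoka parameters,
Andreev's function,
Harnik–Raz / the CKR function f_HR); whether to restate #2/#3 for
`Literature.Computability.Complexity.cliqueFn` on
edge variables (needs an edge-vector ↔ `Fin n` re-indexing lemma) instead of ∃ L ∈ NP; circuit vs
formula versions
(negation-limited formulas have tight ≈ (1/2)·log n thresholds [Rossman2015]); the r-hard-pair lemma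
with 2^{-r} loss
(Jukna2012 Exercise 9.7) as the glue of a foreseen split #2 ⇐ (an r-hard pair inside an NP language
for r = ε log n)
→ (r-hard pair ⇒ size bound at budget r) → #2, k = 2. No layer-2 items until a rung closes.

CHEAPEST FALSIFIER. Statement level (minutes, by inspection — refuters first): the junk-value audit
of the three
cruxes as typed — #2/#3 need an NP language whose slices admit circuits with that few negations at
infinitely many n
(monotone padded CLIQUE does, by `markov_upper`), #4 needs NON-CONSTANT monotone slices at EVERY
large n
(`circuitSizeOver monotoneBasis` is 0 on constant slices since {∧₂, ∨₂} has no constants) — a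
candidate L failing this
makes the item false for that L only, but "for every candidate" would be a misstated-refutation.
Line level (an hour
of literature search): a single-output negation-limited GAP theorem at budget O(log log n) — a
monotone function in
NP with superpolynomial monotone complexity but polynomial-size circuits using O(log log n) NOT
gates — would show the
monotone-method fuel cannot climb rung #3 and retire the mechanism (Jukna2012 p.311 prints the
single-output case as
open; the multi-output gap `Literature.Barriers.PneNP.NegationLimitedGap` starts only at log n −
O(log log n)).

NUMBERS. NOT budgets b: 0 = monotone (superpolynomial bounds known [Razborov1985; AlonBoppana1987]);
⌊(1/6)·log₂ log₂ m⌋ for CLIQUE(m, s) [AmanoMaruoka2005, `amano_maruoka`]; ≈ (1/2 − ε)·log₂ n for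
formulas / NC¹
[Rossman2015]; log₂ n − O(1) = fewest negations of a PRF [GuoEtAl2015]; ⌈log₂(n+1)⌉ = Markov's
border, where Fischer's
simulation costs ≤ 2t + c(n² log² n + 1) (`fischer_negationLimited`, discharged;
BealsNishinoTanaka1998 improve the
inverter to O(n log n)) and B₂ → {∧₂, ∨₂, ¬} costs ≤ 12s + 3 (`Circuit.exists_deMorgan_of_B2`).
Monotone size records:
exp(Ω(√n/log n)) for f_HR [CavalarKumarRossman2022 Thm 2.19]; 2^{Θ(n)} for monotone formulas,
switching networks and
span programs [PitassiRobere2017]; multi-output negation gap for every r ≤ log₂ n − C₀ log₂ log₂ n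
[Jukna2004;
Jukna2012 Thm 10.21].
Sources: Jukna2012 (§§1.2, 9.9, 10.2–10.5); Markov1958; Fischer1975; BealsNishinoTanaka1998;
AmanoMaruoka2005;
Rossman2015; Razborov1985; AlonBoppana1987; Tardos1988; RazborovRudich1997; CavalarKumarRossman2022
(arXiv:2012.03883);
arXiv:1908.08483; PitassiRobere2017; GargEtAl2018; GuoEtAl2015; Oliveira2015; BlaisEtAl2015
(arXiv:1410.8420);
CanonneEtAl2019; Jukna2004; AroraBarak2009; arXiv:2512.19515; arXiv:2507.16105.

DEFINITION REQUESTS. None open: `Circuit.negationCount`, `negLimitedSizeOver` (wi-03885) and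
Markov's `decrease`
landed in Literature/Computability/Complexity/NegationLimited.lean; the facts `markov_upper` /
`markov_lower` /
`fischer_negationLimited` / `amano_maruoka` requested by this route (wi-03882/03883) landed and are
DISCHARGED
(MarkovInversion, NegationLimitedMarkovProofs, NegationLimitedProofs, AmanoMaruokaProofs).

Novelty: NOVELTY (retriage pass 2026-08-14; search-before-claim: lit search "negation-limited circuits lower
bound" / "negations cryptography pseudorandom functions monotone" / "learning circuits with few
negations" / "strongly exponential lower bounds monotone computation"; lit vsearch
(negation-limited, > log log n negations); lit galaxy search "negation-limited circuit" --star pdf;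
lit frontier PneNP --since 2020; lit bridges PneNP --cross any; lit read of every hit named below).
Nearest prior art actually found:
- Thesis X and rungs #2/#3 are the printed programme of Jukna2012 §10.5 (PDF p.310: classes P^(r);
"If CLIQUE ∉ P^(r) for r = ⌈log(n+1)⌉, then P ≠ NP"; the parameter R(f), 0 ≤ R(f) ≤ ⌈log(n+1)⌉) and
§9.9 Research Problem 9.29 (PDF p.288: "Exhibit an explicit pair A, B … which is r-hard for r ≫ log
log n"; "the clique function produces an r-hard pair for r about log log n", Amano and Maruoka
2005). Record for unbounded-depth circuits: (1/6)·log log n NOT gates for CLIQUE [AmanoMaruoka2005;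
tree fact Literature.Computability.Complexity.amano_maruoka]. CanonneEtAl2019 (ToC 15, p.6) lists
exactly two extensions of monotone bounds to negation-limited circuits: Amano–Maruoka, and
Rossman2015 (NC¹ circuits / formulas with ≈(1/2)·log n negations via correlation bounds for mNC¹) —
rung #2 is crossed for formulas, not for circuits. Assembly = Markov1958 + Fischer1975 (+
BealsNishinoTanaka1998), tree facts markov_upper / markov_lower / fischer_negationLimited (Jukna2012
Thm 10.18, PD  [refs: 1410.8420, 2012.03883, 1908.08483, 2512.19515, 2507.16105, paper:w2950340987, Jukna2012, AmanoMaruoka2005, CanonneEtAl2019, Rossman2015, Markov1958, Fischer1975, BealsNishinoTanaka1998, GuoEtAl2015, Oliveira2015, BlaisEtAl2015, Jukna2004, CavalarKumarRossman2022, PitassiRobere2017]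

Barriers (technique_class: negation-budget, approximation-method, sunflower-bounds): BARRIERS (catalogue Literature/Barriers/PneNP/*; one line per catalogued barrier met by the
technique class, then the non-applicable ones):
Literature.Barriers.PneNP.NegationLimitedGap: APPLIES to cruxes #2 (ε·log n) and #3 (c·log log n) as
a relevance barrier (Jukna2004; Jukna2012 Thm 10.21 with Claim 10.22, PDF pp.310-311) — for every
budget r ≤ log₂ n − C₀·log₂ log₂ n there are monotone multi-output F ∈ P with F ∉ P^(r) (proved
readings Literature.Barriers.PneNP.NegationLimitedGap.not_transfer, .exists_mem_P_not_mem_Pr), so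
lower bounds at those budgets do not by themselves bear on P vs NP. Evasion: the thesis needs none —
X sits at Markov's border ⌈log₂(n+1)⌉ where transfer IS Markov–Fischer (the entry's evasions_known;
tree facts markov_upper, fischer_negationLimited); #2/#3 are declared milestones, not the
separation. Scope: the gap theorem is multi-output; the single-output analogue is printed as open
(Jukna2012 PDF p.311) and the route's items are single-output NP languages — not literally covered,
but nothing suggests single-output behaves differently.
Literature.Barriers.PneNP.MonotoneGap: APPLIES to the step from fuel #4 to X (Tardos1988;
Razborov1985b; Jukna2012 Thm 9.28/9.38) — monotone COMPLEXITY never transfers with polynomial loss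
(Literature.Barriers.PneNP.MonotoneGap.not_monotoneTransfer_pow); 2025 separations are sharper still
(arXiv:2512.19515). Evasion (the entry's own listed one, and the route's bet): carry the
approximation METHOD — test-set inseparabil

Novelty grade: known — route-review grade (refuter): KNOWN programme. Thesis X = NP ⊄ P/poly restated through Markov–Fischer (Jukna2012 §10.5 prints exactly 'If CLIQUE ∉ P^(r) for r = ⌈log(n+1)⌉ then P ≠ NP' and the strategy 'extend the bound to circuits with a larger and larger number r of allowed NOT gates'); rungs #2/# (refuter refuter-rreview1-PneNP-NegLimited-f0bd07b7-0, 2026-08-15T18:33:35Z; prior: Jukna2012 §10.5 (PDF pp.309-311: P^(r), R(f), 'extend the bound to larger and larger r', Thm 10.21), Jukna2012 §9.9 Research Problem 9.29 (PDF p.288) and Research Problem 10.23 (PDF p.312), AmanoMaruoka2005 doi:10.1137/s0097539701396959, Markov1958; Fischer1975; BealsNishinoTanaka1998 doi:10.1137/s0097539794275136, SungTanaka1997 RIMS Kokyuroku 992 §3 (galaxy pdf:6018511941746887260); SungTanaka20)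

History (route lifecycle, newest last):
- 2026-08-15T17:00:27Z · rev 2: restated Assembly (stmt-PneNP-0410) — route-repair (glue.missing/extra-hypothesis + rationale-missing): deciding theorem `closes : NeglimitedThesis → PneNP` PROVED outright in the file (¬PneNP ⇒ L ∈ (planner-rbadge-PneNP-NegLimited-f0bd07b7-g2-0)
- 2026-08-16T04:14:30Z · AUTO-CRUX (backfill): NeglimitedThesis — hypotheses of the deciding theorem that nothing in the route derives are cruxes (operator:999:1085951)
- 2026-08-23T17:49:13Z · DORMANT — reconciler: no traction for 6.2 d (last activity item-evidence-added at 2026-08-17T13:31:00Z); parked, not closed — `ledger route dormant route-PneNP-NegLimited (operator:999:1381366)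
- 2026-08-25T20:06:07Z · REACTIVATED — reactivated on director-frontier 19:58:01Z (3): pnp-ideate-p3 D-0059 target maps to this route (operator:999:506694)

sub-problem: PneNP · status: open · opened planner-PneNP-Survey-0 2026-08-13T06:33:40Z · rev 4 · ledger route-PneNP-NegLimited
GENERATED by the gate from the ledger (D-0016/17). Provers cite these decls: `theorem foo : Summit.PneNP.PneNP.Theses.NegLimited.<Decl> := …` in Summits/PneNP/PneNP/Theorems/<Name>.lean.
-/

namespace Summit.PneNP.PneNP.Theses.NegLimited

open scoped BigOperators Topology Manifold Classical MeasureTheory ProbabilityTheory Matrix InnerProductSpace ComplexConjugate ContinuousMap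
open Filter Set Function TopologicalSpace MeasureTheory

attribute [summit_statement] _root_.PneNP

open Literature.PNP

/-- item stmt-PneNP-0409 · crux (kind.auto-crux: conjecture-grade) · rank 0 · open · by planner
why it might fail: X ⇔ NP ⊄ P/poly (Fischer: ⌈log₂(n+1)⌉ NOTs cost ≤2t+O(n²log²n), fischer_negationLimited), so ¬X ⇔ NP ⊆ P/poly is consistent with all known bounds; at this budget the class is all of P/poly, so NaturalProofs (RR97 Thm 4.1) and the monotone/negation gaps (Tardos1988; Jukna2004) bite in full.
sources: Jukna2012 §10.5 (PDF p.310), Fischer1975, Markov1958, BealsNishinoTanaka1998, RazborovRudich1997, Tardos1988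
Route thesis of PneNP/NegLimited. There is L ∈ NP such that for every k, for infinitely many n,
every circuit over {∧₂,∨₂,¬} computing the slice L∩{0,1}ⁿ with at most ⌈log₂(n+1)⌉ negation gates
has more than n^k gates. By Markov–Fischer (⌈log₂(n+1)⌉ negations suffice for any function with
polynomial overhead) this is equivalent to NP ⊄ P/poly; the point of the formulation is the negation
budget as an interpolation parameter between monotone (known) and general circuits [Jukna2012, §10;
AmanoMaruoka2005 (bib key missing)]. [sources: Jukna2012; AmanoMaruoka2005; Fischer1975] [route
PneNP/NegLimited, rank 0] -/
@[route_item "route-PneNP-NegLimited", crux]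
def NeglimitedThesis : Prop :=
  ∃ L ∈ Literature.Computability.Complexity.Nondeterministic.NP, ∀ k : ℕ, ∃ᶠ n in Filter.atTop, ∀ C : Literature.Computability.Complexity.Circuit (Fin n), C.IsOver Literature.Computability.Complexity.deMorganBasis → C.Computes (L.sliceFn n) → C.sizeWith (fun g => if g = Literature.Computability.Complexity.GateFn.not then 1 else 0) ≤ Nat.clog 2 (n + 1) → n ^ k < C.size

/-- item stmt-PneNP-0411 · aside · rank 2 · closed · proved by Summit.PneNP.PneNP.Theorems.neglimitedEpsLogNegations_holds (prover) · by planner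
why it might fail: r NOTs cost a 2^-r loss in both-direction monotone inseparability (r-hard pairs, Jukna2012 Ex.9.7), so r=ε·log n needs n^-ε-correlation-type bounds for poly-size monotone CIRCUITS of any depth—known only for mNC¹ (Rossman2015: (1/2−ε)log n NOTs); circuits stuck at r≈(1/6)loglog n since 2005.
sources: AmanoMaruoka2005, Jukna2012 §9.9 (PDF pp.287-288, RP 9.29), §10.5 (PDF p.310), Rossman2015, CanonneEtAl2019 p.6, Literature.Computability.Complexity.amano_maruoka, Literature.Barriers.PneNP.NegationLimitedGap
Hardest/most informative crux: push the negation budget from Θ(log log n) (known: (1/6)·log log n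
for CLIQUE, Amano–Maruoka 2005, SIAM J. Comput. 35) to ε·log₂ n. Implied by the thesis (fewer
negations allowed); the Amano–Maruoka decomposition into 2^b monotone sub-functions consumes a
monotone lower bound of size ≫ 2^{b}·poly, so at b = ε log n it needs truly exponential,
decomposition-robust monotone bounds (crux #4). [Jukna2012, §10.3] [sources: AmanoMaruoka2005;
Jukna2012] [route PneNP/NegLimited, rank 2] -/
@[route_item "route-PneNP-NegLimited"]
def NeglimitedEpsLogNegations : Prop :=
  ∃ L ∈ Literature.Computability.Complexity.Nondeterministic.NP, ∃ ε : ℝ, 0 < ε ∧ ∀ k : ℕ, ∃ᶠ n : ℕ in Filter.atTop, n ^ k < Literature.Computability.Complexity.negLimitedSizeOver Literature.Computability.Complexity.deMorganBasis ⌊ε * Real.logb 2 n⌋₊ (L.sliceFn n)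

-- `NeglimitedEpsLogNegations` holds: proved by `Summit.PneNP.PneNP.Theorems.neglimitedEpsLogNegations_holds` (its module imports this route file, so no `_holds` link can be stated here).

/-- item stmt-PneNP-19860 · banked · rank 2 · closed · proved by Summit.PneNP.PneNP.Theorems.NegLimitedAmplifiedWindow.neglimitedEpsLogNegationsR_via_amplifiedWindow (prover) · by planner
[crux] Repaired crux #2 (= aside item stmt-PneNP-0411 + the Monotone (L.sliceFn n) guard the
route-review refuter asked for on 2026-08-15, which removes parity-of-blocks witnesses): ONE
explicit NP language with monotone slices beats every polynomial against De Morgan circuits with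
⌊ε·log₂ n⌋ NOT gates for a fixed ε > 0 = the level of Jukna Research Problem 10.23 (Ω(log n)
negations for an explicit monotone function). Strictly between stmt-PneNP-19657 (log n/(40 loglog
n), proved in the cell modulo landing) and the thesis stmt-PneNP-0409. Why it might fail / why it is
hard: every restriction-kill scheme whose kills are certified by an approximation-method engine
(Razborov 85, Amano–Maruoka 05, CKR 22, CGRSS 25) is capped at Θ(log n/loglog n) negations by one
inequality (r-small approximators need r ≥ log₂ t, so a certified host-kill costs ≥ log₂log₂ t bits
of the log₂ n density budget; ROUND-4.md §7.2–7.3, with a matching block-certifier adversary at the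
top scale); lifting it needs a monotone lower bound with FAT positives (Q_rel, ROUND-4 §7.6) or a
non-kill idea; print record (1/6) loglog n (AmanoMaruoka2005). NOT to be staffed by provers: this is
the door, typed for refuter/lite -/
@[route_item "route-PneNP-NegLimited"]
def NeglimitedEpsLogNegationsR : Prop :=
  ∃ L ∈ Literature.Computability.Complexity.Nondeterministic.NP, ∃ ε : ℝ, 0 < ε ∧ ∀ k : ℕ, ∃ᶠ n : ℕ in Filter.atTop, Monotone (L.sliceFn n) ∧ n ^ k < Literature.Computability.Complexity.negLimitedSizeOver Literature.Computability.Complexity.deMorganBasis ⌊ε * Real.logb 2 n⌋₊ (L.sliceFn n)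

-- `NeglimitedEpsLogNegationsR` holds: proved by `Summit.PneNP.PneNP.Theorems.NegLimitedAmplifiedWindow.neglimitedEpsLogNegationsR_via_amplifiedWindow` (its module imports this route file, so no `_holds` link can be stated here).

/-- item stmt-PneNP-0412 · aside · rank 3 · closed · proved by Summit.PneNP.PneNP.Theorems.neglimitedAllCLoglogNegations_holds (prover) · by planner
why it might fail: Known only to r≈(1/6)loglog n via CLIQUE's r-hard pair (AmanoMaruoka2005; Jukna2012 p.288), unimproved for unbounded-depth circuits (CanonneEtAl2019 p.6); 'every c' is a weak form of open RP 9.29 (r≫loglog n); route names no new pair/NOT-charging step. c=0 needs CLIQUE∈CplxCore.NP (TM verifier).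
sources: AmanoMaruoka2005, Jukna2012 §9.9 RP 9.29 (PDF p.288), §10.5 (PDF p.310), CanonneEtAl2019 p.6, Razborov1985, AlonBoppana1987, Literature.Computability.Complexity.amano_maruoka
First milestone: remove the constant 1/6 in Amano–Maruoka's (1/6)·log log n negation budget for
CLIQUE — for every c some NP language (L may depend on c) needs superpolynomial De Morgan circuits
with c·⌊log₂⌊log₂ n⌋⌋ NOT gates. Implied by #2. Known for c·log log n only with c ≤ 1/6
[AmanoMaruoka2005; Jukna2012, Thm 10.8-area — grounder to pin exact statement]. [sources:
AmanoMaruoka2005; Jukna2012] [route PneNP/NegLimited, rank 3] -/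
@[route_item "route-PneNP-NegLimited"]
def NeglimitedAllCLoglogNegations : Prop :=
  ∀ c : ℕ, ∃ L ∈ Literature.Computability.Complexity.Nondeterministic.NP, ∀ k : ℕ, ∃ᶠ n : ℕ in Filter.atTop, n ^ k < Literature.Computability.Complexity.negLimitedSizeOver Literature.Computability.Complexity.deMorganBasis (c * Nat.log 2 (Nat.log 2 n)) (L.sliceFn n)

-- `NeglimitedAllCLoglogNegations` holds: proved by `Summit.PneNP.PneNP.Theorems.neglimitedAllCLoglogNegations_holds` (its module imports this route file, so no `_holds` link can be stated here).

/-- item stmt-PneNP-19657 · support · rank 3 · closed · proved by Summit.PneNP.PneNP.Theorems.neglimitedLogOverLoglogNegations_holds (prover) · by planner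
why it might fail: Proved in the cell (kernel, 0 sorry: HOME/pnp-ideate-p3/Theorems-NegLimitedLogOverLoglogSlices.lean + chain ConcatAll-T1-S5.lean rc 0); only the landing order (LANDING.md rows 2-6) stands between it and a Theorems file.
sources: AmanoMaruoka2005, Jukna2012 §10.5, AroraBarak2009 §6.1
[crux] Rung strictly between crux #3 (stmt-PneNP-0412, c·loglog n NOTs) and crux #2
(stmt-PneNP-0411, ε·log n): ONE explicit NP language with monotone slices at square lengths beats
every polynomial against De Morgan circuits with ⌊log₂ n⌋/(40(⌊log₂⌊log₂ n⌋⌋+1)) = Θ(log n/log log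
n) NOT gates (print record for an explicit function in unbounded depth: (1/6)·log log n,
AmanoMaruoka2005; Jukna2012 §10.5 p.310, RP 9.29 p.288). PROVED in the cell, kernel-checked, 0
sorry, tree-ready split with gate dry-runs lint-clean:
HOME=run/shared/lean/pub/pnp-ideate/pnp-ideate-p3/LANDING.md rows 1-7 (engine T1
NegLimLog.cliqueLikeNegLimitedLog = Amano–Maruoka induction on razborov_dichotomy_wide relativised
to a live vertex set; slices = Tardos function of the upper triangle of an m×m bit matrix, L ∈ P;
by-name theorem NegLimSlices.neglimitedLogOverLoglogNegations in
Theorems-NegLimitedLogOverLoglogSlices.lean; whole chain ConcatAll-T1-S5.lean 1667 lines farm rc 0).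
Same bound for an NP-complete witness (⌊√m⌋-CLIQUE slices): Theorems-NegLimitedCliqueSlices.lean
(rows 8-9). Why it might fail: nothing mathematical remains — landing/review of the staged files (a
prover files them; defs are review-queu -/
@[route_item "route-PneNP-NegLimited"]
def NeglimitedLogOverLoglogNegations : Prop :=
  ∃ L ∈ Literature.Computability.Complexity.Nondeterministic.NP, ∀ k : ℕ, ∃ᶠ n : ℕ in Filter.atTop, Monotone (L.sliceFn n) ∧ n ^ k < Literature.Computability.Complexity.negLimitedSizeOver Literature.Computability.Complexity.deMorganBasis (Nat.log 2 n / (40 * (Nat.log 2 (Nat.log 2 n) + 1))) (L.sliceFn n)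

-- `NeglimitedLogOverLoglogNegations` holds: proved by `Summit.PneNP.PneNP.Theorems.neglimitedLogOverLoglogNegations_holds` (its module imports this route file, so no `_holds` link can be stated here).

/-- item stmt-PneNP-19888 · support · rank 3 · closed · proved by Summit.PneNP.PneNP.Theorems.NegLimitedHalfWindow.neglimitedHalfLogNegationsR_via_halfWindow (prover) · by planner
[crux] R2, next rung after the door NeglimitedEpsLogNegationsR (which it implies with eps := 1/4,
door_of_halfLog proved in HOME/pnp-ideate-p3/r13/Sketch-R13.lean): for every eps > 0 an NP language
with monotone slices needs super-polynomial De Morgan circuits of UNBOUNDED depth when only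
floor((1/2 - eps) log2 n) NOT gates are allowed (Rossman CCC 2015 Cor. 1.4 has this constant for
NC^1 only, p.395). Mechanism: landed B (critical-window CLIQUE hardness) + generic monotone
amplification with combiner TRIBES_{w,m} o RM3_d^{mw}, d = Theta(log w), whose expected restricted
bias is O~(k^{-1/2}) by an exact second-moment identity (TribesBiasResponse, Sketch-R13) + the
in-tree gap-form transfer one_le_negations_mul_gap. Why it might fail: the tribes imbalance O(w/k)
and the 1/|W| junk term must stay below the k^{-1/2} scale (they do numerically: RHS*sqrt(k/w) ->
0.90); the method's ceiling is exactly (1/2) log2 n by O'Donnell-Wimmer (Rossman p.395 L15-19), so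
no slack in the exponent. Sources: paper:url-c38bae016d20 (Rossman CCC15) p.394-395;
paper:doi-10-1016-j-jcss-2004-01-001 (O'Donnell JCSS04) Thm 2, p.20; AmanoMaruoka2005;
HOME/pnp-ideate-p3/ROUND-13.md -/
@[route_item "route-PneNP-NegLimited"]
def NeglimitedHalfLogNegationsR : Prop :=
  ∀ ε : ℝ, 0 < ε → ∃ L ∈ Literature.Computability.Complexity.Nondeterministic.NP, ∀ k : ℕ, ∃ᶠ n : ℕ in Filter.atTop, Monotone (L.sliceFn n) ∧ n ^ k < Literature.Computability.Complexity.negLimitedSizeOver Literature.Computability.Complexity.deMorganBasis ⌊(1 / 2 - ε) * Real.logb 2 n⌋₊ (L.sliceFn n)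

-- `NeglimitedHalfLogNegationsR` holds: proved by `Summit.PneNP.PneNP.Theorems.NegLimitedHalfWindow.neglimitedHalfLogNegationsR_via_halfWindow` (its module imports this route file, so no `_holds` link can be stated here).

/-- item stmt-PneNP-0413 · aside · rank 4 · open · by planner
why it might fail: 2^Ω(n) for explicit monotone f is open (arXiv:2012.03883 p.3; record exp(Ω(√n/log n)), Thm 2.19); §2.8: spreadness+sunflower bounds near-optimal, 'to get beyond 2^Ω(√n) another approach seems to be required'; 2^Ω(n) only for mon. formulas/span programs (PitassiRobere2017). ∀ᶠn: hard slice at each n.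
sources: arXiv:2012.03883 p.3, Thm 2.19, §2.8 (p.9), arXiv:1908.08483 Thm 1.9, CavalarKumarRossman2022, PitassiRobere2017, paper:w2950340987 (Robere 2018 thesis) pp.70-71, Problem 2, Razborov1985
Some NP language whose slices are (eventually) non-constant monotone functions requires monotone
circuits of size 2^{εn} on n input bits. (circuitSizeOver monotoneBasis has junk value 0 for
non-monotone or constant slices, so the inequality itself forces monotone non-constant slices.)
Record: exp(n^{1/2-o(1)}) via robust sunflowers [arXiv:2012.03883], building on the
Alweiss–Lovett–Wu–Zhang sunflower lemma [arXiv:1908.08483]; classical m^{C log m} for CLIQUE is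
Literature.Computability.Complexity.razborov_alon_boppana [Razborov1985; AlonBoppana1987]. A
well-known open problem (Jukna 2012, §9). It is the quantitative input the 2^b-decomposition in #2
needs. [sources: arXiv:2012.03883; arXiv:1908.08483; Razborov1985; AlonBoppana1987; Jukna2012]
[route PneNP/NegLimited, rank 4] -/
@[route_item "route-PneNP-NegLimited"]
def NeglimitedTrulyExponentialMonotone : Prop :=
  ∃ L ∈ Literature.Computability.Complexity.Nondeterministic.NP, ∃ ε : ℝ, 0 < ε ∧ ∀ᶠ n : ℕ in Filter.atTop, (2 : ℝ) ^ (ε * n) ≤ (Literature.Computability.Complexity.circuitSizeOver Literature.Computability.Complexity.monotoneBasis (L.sliceFn n) : ℝ)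

/-- item stmt-PneNP-19932 · support · rank 4 · open · by planner
[crux] Rung R_P of the negation ladder = Jukna 2012, Boolean Function Complexity, Sec. 10.5,
RESEARCH PROBLEM 10.23 (explicit sequence of monotone one-output functions f_n with R(f_n) =
Omega(log n); R(f) is non-vacuous only for f in P) with r = eps*log2 n: a language L in P, ALL of
whose slices are monotone, such that for some eps > 0 and every k, infinitely often, every
AND/OR/NOT circuit (unbounded depth) with at most floor(eps*log2 n) NOT gates computing the slice
has size > n^k. Implies the CLOSED door NeglimitedEpsLogNegationsR via P_subset_NP_holds (checked,
p3 g13 scratch/rp23.lean); the door is the NP-explicit analogue (its slices RM3 o kc-CLIQUE are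
NP-hard for large kc). WHY IT MIGHT FAIL / WHY HARD: the door engine transfers verbatim (generic
amplification A-gen, transfer T, slices S even easier in P), but the BASE must be a P-computable
monotone function that is CONSTANT-ERROR hard under an FKG/product measure against ALL
polynomial-size monotone circuits; no such average-case bound is in print; every CLIQUE-based base
has clique size kc = Theta(c) against size n^c, and padding the length to n^kc (to land in P) leaves
hardness only against size len^(c/kc) < len^(1/8) ( -/
@[route_item "route-PneNP-NegLimited"]
def NeglimitedEpsLogNegationsP : Prop :=
  ∃ L ∈ Literature.Computability.Complexity.Classes.P, (∀ n : ℕ, Monotone (L.sliceFn n)) ∧ ∃ ε : ℝ, 0 < ε ∧ ∀ k : ℕ, ∃ᶠ n : ℕ in Filter.atTop, n ^ k < Literature.Computability.Complexity.negLimitedSizeOver Literature.Computability.Complexity.deMorganBasis ⌊ε * Real.logb 2 n⌋₊ (L.sliceFn n)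

/-- item stmt-PneNP-19555 · support · rank 9 · closed · proved by Summit.PneNP.PneNP.Theorems.neglimitedLogOverOmegaNegations_holds (prover) · by planner
[support] R9-B (pnp-ideate-p3 ROUND-9 §B, line density-ladder): the rung strictly between the closed
stmt-PneNP-19657 (log n/(40 loglog n) NOTs) and the door stmt-PneNP-19860 (ε·log n): ONE explicit NP
language with monotone slices beats every polynomial against De Morgan circuits with ⌊log₂ n⌋/w(n)
NOT gates for EVERY unbounded w (door = w bounded; w = 40(loglog n+1) gives 19657 verbatim).
Mechanism (new for unbounded depth): Rossman CCC 2015 transfer (L1.3/L3.2 = landed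
NegLimitedDoor.stub_amCoverMonPairs + stub_flipProbLeSum) needs only a MONOTONE COUPLING, not an FKG
law — couple X⁻ ~ G(m,p_J) at a RANDOM density p_j = 1−(1−p⁻)^j (J uniform ≤ T = ⌊m^{2δ/(k−1)}⌋, all
subcritical) with X⁺ = X⁻ ∪ K_A; the PROVED relative Rossman 2010 Thm 1 (rsd_at_admissible_dose) +
the union law (sum_sum_gnpWeight_mul_sup: G(p_j) ∪ G(p⁻) = G(p_{j+1}) exactly) make the advantage of
every monotone sub-circuit of size < m^{k/4} TELESCOPE to ≤ η + e^{−m^{c′}} + 1/(T+1) ≈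
3m^{−2/(k³(k−1))}, while k-CLIQUE flips w.p. ≥ 1−2/k!; hence CLIQUE(m,k) needs > m^{k/4}−1 gates
against ⌊log₂ m⌋/k⁴ NOTs for every fixed k ≥ 5 (engine statement NeglimitedCliqueFixedK), and k =
16c+17 recurring in one padded clique -/
@[route_item "route-PneNP-NegLimited"]
def NeglimitedLogOverOmegaNegations : Prop :=
  ∃ L ∈ Literature.Computability.Complexity.Nondeterministic.NP, ∀ w : ℕ → ℕ, Filter.Tendsto w Filter.atTop Filter.atTop → ∀ c : ℕ, ∃ᶠ n : ℕ in Filter.atTop, Monotone (L.sliceFn n) ∧ n ^ c < Literature.Computability.Complexity.negLimitedSizeOver Literature.Computability.Complexity.deMorganBasis (Nat.log 2 n / w n) (L.sliceFn n)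

-- `NeglimitedLogOverOmegaNegations` holds: proved by `Summit.PneNP.PneNP.Theorems.neglimitedLogOverOmegaNegations_holds` (its module imports this route file, so no `_holds` link can be stated here).

/-- item stmt-PneNP-19658 · support · rank 9 · closed · proved by Summit.PneNP.PneNP.Theorems.neglimitedAllCLoglogNegationsR_holds (prover) · by planner
[support] stmt-PneNP-0412 (NeglimitedAllCLoglogNegations) in the REPAIRED form the route-review
refuter asked for on 2026-08-15 (Monotone (L.sliceFn n) inside the ∃ᶠ removes the
parity-of-perfect-matchings witness): for every c, ONE explicit NP language with monotone slices at
square lengths beats every polynomial with c·⌊log₂⌊log₂ n⌋⌋ NOT gates. PROVED in the cell (0 sorry,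
farm rc 0) from the in-tree Literature.Barriers.PneNP.cliqueLike_sqrt_negationLimited_sqrtLog + the
slice plumbing: by-name theorem NegLimSlices.neglimitedAllCLoglogNegationsR in
HOME=run/shared/lean/pub/pnp-ideate/pnp-ideate-p3/Theorems-NegLimitedLoglogSlices.lean (LANDING.md
row 5; the same file proves #3 itself by name — attached as evidence on stmt-PneNP-0412). Implied by
NeglimitedLogOverLoglogNegations (budget comparison, eventually). Sources: AmanoMaruoka2005;
Jukna2012 §9.9 RP 9.29 (p.288), §10.5 (p.310); refuter note on stmt-PneNP-0412 (2026-08-15) -/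
@[route_item "route-PneNP-NegLimited"]
def NeglimitedAllCLoglogNegationsR : Prop :=
  ∀ c : ℕ, ∃ L ∈ Literature.Computability.Complexity.Nondeterministic.NP, ∀ k : ℕ, ∃ᶠ n : ℕ in Filter.atTop, Monotone (L.sliceFn n) ∧ n ^ k < Literature.Computability.Complexity.negLimitedSizeOver Literature.Computability.Complexity.deMorganBasis (c * Nat.log 2 (Nat.log 2 n)) (L.sliceFn n)

-- `NeglimitedAllCLoglogNegationsR` holds: proved by `Summit.PneNP.PneNP.Theorems.neglimitedAllCLoglogNegationsR_holds` (its module imports this route file, so no `_holds` link can be stated here).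

/-- item stmt-PneNP-19681 · support · rank 9 · closed · proved by Summit.PneNP.PneNP.Theorems.neglimitedInverseLinearNegations_holds (prover) · by planner
[support] R10 rung of the negation ladder (rung F-N1/p3, ROUND-10; line `sparse-ladder`): ONE NP
language (the recurring padded clique language of NegLimitedLadderRecurringCliqueSlices.lean) whose
monotone slices need size > n^c against ⌊log₂ n⌋/(48c+78) NOT gates, for EVERY c, infinitely often —
i.e. ε·log₂ n negation gates still force size n^{Ω(1/ε)} (inverse-linear negations/size-exponent
trade-off). Implies NegLimited.NeglimitedLogOverOmegaNegations (R9-B: (log n)/w(n) for every w → ∞)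
and pins the RATE Θ(1/c); it is NOT the door NeglimitedEpsLogNegationsR (ε log n for all c at once),
which stays the route's crux. ENGINE: Rossman 2010 Theorem 1 with SPARSE noise relative to an
arbitrary background (tree, PROVED: Literature.Computability.Complexity.thm1_sparse_relative — class
parameter k′ = 4(c+2) for members of size ≤ n^c, sprinkle density n^{−ρ}, ρ < 2/k′ INDEPENDENT of
the clique size k) run along the density ladder p_j = 1 − (1 − n^{−ρ})^j of ROUND-9 (K = 4c+8, k =
2K+1 = 8c+17, δ = 1/(2K), ρ = 3/(2K), window a = ρ − 2/(k−1) = 1/(8c+16) > budget exponent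
1/(8c+18), rungs j ≤ ⌊n^a⌋ all K_k-subcritical, accuracy η = n^{−1/2} since the I/J signature-weight
sums are O_k(n^{−1}) -/
@[route_item "route-PneNP-NegLimited"]
def NeglimitedInverseLinearNegations : Prop :=
  ∃ L ∈ Literature.Computability.Complexity.Nondeterministic.NP, ∀ c : ℕ, ∃ᶠ n : ℕ in Filter.atTop, Monotone (L.sliceFn n) ∧ n ^ c < Literature.Computability.Complexity.negLimitedSizeOver Literature.Computability.Complexity.deMorganBasis (Nat.log 2 n / (48 * c + 78)) (L.sliceFn n)

-- `NeglimitedInverseLinearNegations` holds: proved by `Summit.PneNP.PneNP.Theorems.neglimitedInverseLinearNegations_holds` (its module imports this route file, so no `_holds` link can be stated here).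

/-- item stmt-PneNP-19760 · support · rank 9 · closed · proved by Summit.PneNP.PneNP.Theorems.neglimitedLogOverLoglogClique_holds (prover) · by planner
[support] R35-CLIQUE — NeglimitedLogOverLoglogNegations (stmt-PneNP-19657) with an NP-COMPLETE
witness: an NP language L whose slice at every square length m² is the ⌊√m⌋-CLIQUE problem of the
upper-triangle graph of an m×m bit matrix (stated in matrix coordinates over Mathlib: some ⌊√m⌋-set
S with w_{b+m·a}=1 for all a<b in S), and for every k, infinitely often the slice is monotone and
needs > n^k De Morgan gates under ⌊log₂ n⌋/(40(⌊log₂⌊log₂ n⌋⌋+1)) NOT gates. Point: at Markov's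
border (crux #1/thesis ⇔ NP ⊄ P/poly) a witness in P is useless (P ⊆ P/poly), so the rung is also
recorded for CLIQUE itself; print record for CLIQUE is (1/6)·log log n NOTs (AmanoMaruoka2005;
Jukna2012 §10.5 p.310). PROVED in the cell, 0 sorry, farm rc 0: L = sqrtCliqueLang ∈ NP by an
explicit FP certificate verifier
(HOME=run/shared/lean/pub/pnp-ideate/pnp-ideate-p3/Literature-CliqueVerifierBricks.lean,
CliqueVerifier.verFn_mem_FP / verFn_sq) and theorem NegLimSlices.neglimitedLogOverLoglogClique
(exactly this type) in Theorems-NegLimitedCliqueSlices.lean, engine T1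
NegLimLog.cliqueLikeNegLimitedLog; chain ConcatAll-T1-S5-CLQ.lean (farm rc 0). Landing: LANDING.md
rows 8-9 (prover). Why it might fail: n -/
@[route_item "route-PneNP-NegLimited"]
def NeglimitedLogOverLoglogClique : Prop :=
  ∃ L ∈ Literature.Computability.Complexity.Nondeterministic.NP, (∀ m : ℕ, 1 ≤ m → ∀ w : Fin (m * m) → Bool, L.sliceFn (m * m) w = true ↔ ∃ S : Finset (Fin m), S.card = Nat.sqrt m ∧ ∀ a ∈ S, ∀ b ∈ S, a < b → ∀ h : (b : ℕ) + m * (a : ℕ) < m * m, w ⟨(b : ℕ) + m * (a : ℕ), h⟩ = true) ∧ ∀ k : ℕ, ∃ᶠ n : ℕ in Filter.atTop, Monotone (L.sliceFn n) ∧ n ^ k < Literature.Computability.Complexity.negLimitedSizeOver Literature.Computability.Complexity.deMorganBasis (Nat.log 2 n / (40 * (Nat.log 2 (Nat.log 2 n) + 1))) (L.sliceFn n)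

-- `NeglimitedLogOverLoglogClique` holds: proved by `Summit.PneNP.PneNP.Theorems.neglimitedLogOverLoglogClique_holds` (its module imports this route file, so no `_holds` link can be stated here).

/-- item stmt-PneNP-19861 · support · rank 9 · closed · proved by Summit.PneNP.PneNP.Theorems.gapPerfectMatchingQuasipoly_holds (prover) · by planner
[support] T5 = gap version of Razborov 1985b (logical permanent): for every K ≥ 2, monotone circuits
that accept every bipartite graph with a perfect matching and reject every graph of deficiency ≥ m/K
(no matching larger than m − m/K) need ≥ m^{c log m} gates, eventually in m. NOT a corollary of the
exact bound by block copying (linear deficiency forces constant-size blocks). Proof plan on the tree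
engine Literature.Computability.Complexity.PerfectMatching.razborov_dichotomy (general f;
PerfectMatchingLowerBound.lean:47): negative test inputs = θ-biased 2-colourings (θ = 1/K,
deficiency = colour imbalance ≥ m/K whp), Jukna Lemma 9.35 (GF(2) independence, false for biased
bits) replaced by the biased forest lemma (leaf-peeling: P[no petal monochromatic] ≤ ∏(1 −
p₀^{|P_i|}), proof ROUND-4.md §7.4), Lemma 9.36 measure-free, Case 1 unchanged; est. 700–1000 lines
(weighted re-run of PerfectMatchingColorings 9.35–9.37 + numerics). Role: certified A′-kill of the
matching-side negation programme (ROUND-4 §7) and the cheapest statement on this rail not found in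
print (searches ROUND-4 §6; CGRSS arXiv:2507.16105 §4 treats imbalance-one cuts only). Exponential
form (2^{m^c}, via CGRSS with b -/
@[route_item "route-PneNP-NegLimited"]
def GapPerfectMatchingQuasipoly : Prop :=
  ∀ K : ℕ, 2 ≤ K → ∃ c : ℝ, 0 < c ∧ ∀ᶠ m : ℕ in Filter.atTop, ∀ C : Literature.Computability.Complexity.Circuit (Literature.Computability.Complexity.PerfectMatching.Edge m), C.IsOver Literature.Computability.Complexity.monotoneBasis → (∀ x, Literature.Barriers.PneNP.perfectMatchingFn m x = true → C.eval x = true) → (∀ x, (∀ D : Finset (Literature.Computability.Complexity.PerfectMatching.Edge m), Literature.Computability.Complexity.PerfectMatching.IsMatching D → (∀ e ∈ D, x e = true) → D.card + m / K ≤ m) → C.eval x = false) → (m : ℝ) ^ (c * Real.log m) ≤ C.size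

-- `GapPerfectMatchingQuasipoly` holds: proved by `Summit.PneNP.PneNP.Theorems.gapPerfectMatchingQuasipoly_holds` (its module imports this route file, so no `_holds` link can be stated here).

/-- item stmt-PneNP-19862 · support · rank 9 · closed · proved by Summit.PneNP.PneNP.Theorems.neglimitedNearMarkovNegations_holds (prover) · by planner
[support] T4 = the as-typed (unguarded) negation ladder closes up to log₂ n − c·log₂log₂ n NOT
gates: ONE explicit NP (indeed P) language — the cleanFn-padded ⊕-fold of 2^b copies of the Tardos
language at designed lengths — beats every polynomial against De Morgan circuits with ⌊log₂ n⌋ −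
c⌊log₂⌊log₂ n⌋⌋ negations. Single-output form of Jukna Thm 10.21 via the ⊕-variant of Claim 10.22
(invariant J(r): circuits with ≤ r NOTs computing parityFold(2^r) f ⊕ s have ≥ C_mon(f) gates;
halving proof ROUND-4.md §7.5) + Markov (markov_upper_holds: d(parityFold(2^r) f) = 2^{r−1}) +
MonotoneGap_holds (Tardos 2^{c v^{1/8}}) + the FP/slice bricks of NegLimSlices.lean. Print-device
level (Sung–Tanaka 1997 RIMS-992 §3 Thm 14 two-output K_n; Jukna2012 Claim 10.22 p.311); value:
closes aside item stmt-PneNP-0411 BY NAME with the same device (2^{⌊(log₂ n)/2⌋+1} blocks at its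
designed lengths; T4 itself does not imply 0411 because negLimitedSizeOver is junk 0 below I(L_n))
and pins that the unguarded ladder carries no information below log₂ n − O(loglog n) — everything
informative is in the Monotone-guarded items (stmt-PneNP-19657, NeglimitedEpsLogNegationsR). Est.
1.6–2.4k lines (⊕-halving over the -/
@[route_item "route-PneNP-NegLimited"]
def NeglimitedNearMarkovNegations : Prop :=
  ∃ L ∈ Literature.Computability.Complexity.Nondeterministic.NP, ∃ c : ℕ, ∀ k : ℕ, ∃ᶠ n : ℕ in Filter.atTop, n ^ k < Literature.Computability.Complexity.negLimitedSizeOver Literature.Computability.Complexity.deMorganBasis (Nat.log 2 n - c * Nat.log 2 (Nat.log 2 n)) (L.sliceFn n)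

-- `NeglimitedNearMarkovNegations` holds: proved by `Summit.PneNP.PneNP.Theorems.neglimitedNearMarkovNegations_holds` (its module imports this route file, so no `_holds` link can be stated here).

/-- item stmt-PneNP-19897 · support · rank 9 · closed · proved by Summit.PneNP.PneNP.Theorems.neglimitedLogOverLoglogNegationsAE_holds (prover) · by planner
[support] ALMOST-EVERYWHERE form of R35 (stmt-PneNP-19657): ONE explicit NP language (the padded
⌊√m⌋-clique language: u ↦ u↾⌊√|u|⌋² ∈ sqrtCliqueLang) whose slice at EVERY large length n is
monotone and beats every polynomial against De Morgan circuits with ⌊log₂ n⌋/(100(⌊log₂⌊log₂ n⌋⌋+1))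
NOT gates (∀ᶠ n instead of ∃ᶠ n at squares; constant 100 absorbs log₂ n ≤ 5 log₂⌊√n⌋). PROVED in the
cell, kernel-checked 0 sorry: HOME/pnp-ideate-p3/Theorems-NegLimitedCliqueSlicesAE.lean (259 l,
theorem NegLimSlices.neglimitedLogOverLoglogNegations_ae has exactly this type; chain
ConcatAll-T1-S5-CLQ-AE.lean 2377 l farm rc 0). Why it might fail: it cannot (proved); only landing
order (LANDING.md row 10 after rows 2,4,8,9). Sources: AmanoMaruoka2005 (Thm. engine T1),
AroraBarak2009 §2.1, §6.1. -/
@[route_item "route-PneNP-NegLimited"]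
def NeglimitedLogOverLoglogNegationsAE : Prop :=
  ∃ L ∈ Literature.Computability.Complexity.Nondeterministic.NP, ∀ k : ℕ, ∀ᶠ n : ℕ in Filter.atTop, Monotone (L.sliceFn n) ∧ n ^ k < Literature.Computability.Complexity.negLimitedSizeOver Literature.Computability.Complexity.deMorganBasis (Nat.log 2 n / (100 * (Nat.log 2 (Nat.log 2 n) + 1))) (L.sliceFn n)

-- `NeglimitedLogOverLoglogNegationsAE` holds: proved by `Summit.PneNP.PneNP.Theorems.neglimitedLogOverLoglogNegationsAE_holds` (its module imports this route file, so no `_holds` link can be stated here).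

/-- item stmt-PneNP-20005 · support · rank 9 · closed · proved by Summit.PneNP.PneNP.Theorems.NegLimDirac.diracCertifierSound (prover) · by planner
[support] (pnp-ideate-p3 ROUND-5 §1; negative knowledge for the door crux NeglimitedEpsLogNegationsR
/ stmt-PneNP-19860) DEGREE (Dirac) CERTIFIER IS SOUND IN JUMBLED BIPARTITE GRAPHS: if x ⊆ K_{m,m} is
upper (d,β)-jumbled — e_x(S,T) ≤ d|S||T|/m + β√(|S||T|) for all S ⊆ U, T ⊆ V — and every vertex has
degree ≥ (1/2+θ)d, then x has a matching with ≥ m − ⌈4β²m/(θ²d²)⌉ edges. Proof (half a page): for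
|S| ≥ s₀ := 4β²m/(θ²d²), (1/2+θ)d|S| ≤ e_x(S,N(S)) ≤ d|S||N(S)|/m + β√(|S||N(S)|) forces |N(S)| ≥
(1/2+θ/2)m; symmetric on the right; hence |N(S)| ≥ |S| − ⌈s₀⌉ for all S (three cases); defect Hall
(Mathlib `Finset.all_card_le_biUnion_card_iff_exists_injective` + ⌈s₀⌉ dummy vertices). =
deterministic defect form of the easy direction of LOCAL RESILIENCE of perfect matchings, threshold
1/2 (Sudakov–Vu 2008 arXiv:0706.4104 Thm 3.1; random regular: Ben-Shimon–Krivelevich–Sudakov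
arXiv:0911.4351). CONSEQUENCE (why it is on this route): with β = 3√d (random d-regular bipartite
host) the AND of 2m degree thresholds is a monotone circuit of size ≤ m³ that is sound (rejects
deficiency ≥ θ′m once d ≥ 73/(θ²θ′)) and accepts every ⌊(1/2+θ)d⌋-factor — so the residue Q_rel of
ROUND-4 §7.6 (no poly-size -/
@[route_item "route-PneNP-NegLimited"]
def DiracCertifierSound : Prop :=
  ∀ (m : ℕ) (θ d β : ℝ), 0 < θ → 0 < d → 0 ≤ β → ∀ x : Finset (Fin m × Fin m), (∀ S T : Finset (Fin m), ((x.filter fun e => e.1 ∈ S ∧ e.2 ∈ T).card : ℝ) ≤ d * S.card * T.card / m + β * Real.sqrt (S.card * T.card)) → (∀ u : Fin m, (1 / 2 + θ) * d ≤ ((x.filter fun e => e.1 = u).card : ℝ)) → (∀ v : Fin m, (1 / 2 + θ) * d ≤ ((x.filter fun e => e.2 = v).card : ℝ)) → ∃ D : Finset (Fin m × Fin m), D ⊆ x ∧ Literature.Computability.Complexity.PerfectMatching.IsMatching D ∧ m - ⌈4 * β ^ 2 * m / (θ ^ 2 * d ^ 2)⌉₊ ≤ D.card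

-- `DiracCertifierSound` holds: proved by `Summit.PneNP.PneNP.Theorems.NegLimDirac.diracCertifierSound` (its module imports this route file, so no `_holds` link can be stated here).

-- earlier Assembly (stmt-PneNP-0410, replaced 2026-08-15T17:00:27Z -> stmt-PneNP-11289): retired by None — Literature.Computability.Complexity.fischer_negationLimited → (∃ c : ℕ, ∀ (n : ℕ) (f : (Fin n → Bool) → Bool) (C : Literature.Computability.Complexity.Circuit (Fin n)), 0 < n → C.IsOver Literature.Computability.Complexity.B2 → C.Computes f → ∃ C₁ : Literature.Computability.Complexity.Circuit (F
/-- item stmt-PneNP-11289 · assembly · rank 1 · closed · proved by Summit.PneNP.PneNP.Theorems.negLimited_assembly_proof @ 89ee2519d290 (prover) · by planner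
[assembly] the thesis implies the sub-problem statement (Markov–Fischer transfer). PROVED in this
file as the deciding theorem `closes` (via P_subset_PPoly_holds, NP_bool_eq_holds, P_bool_eq_holds,
Circuit.exists_deMorgan_of_B2, fischer_negationLimited_holds), so this item is closable by `fun hX
=> closes hX`; it replaces the rev-1 form that carried those named facts (and the unused
P_subset_NP) as unlisted hypotheses. [sources: Fischer1975; Markov1958; Jukna2012 §10.4;
AroraBarak2009 Thm 6.6] -/
@[route_item "route-PneNP-NegLimited"]
def Assembly : Prop :=
  NeglimitedThesis → PneNP

-- `Assembly` holds: proved by `Summit.PneNP.PneNP.Theorems.negLimited_assembly_proof` @ 89ee2519d290 (its module imports this route file, so no `_holds` link can be stated here).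

/-! D-0027 §2.1 — DECIDING THEOREM (planner-authored via `route open/edit --closes-file`; by planner-rbadge-PneNP-NegLimited-f0bd07b7-g2-0 2026-08-15T17:00:27Z):
its hypotheses are this route's items and its conclusion the sub-problem Statement (glue_lint), and it elaborates with this file. -/

-- Deciding theorem (D-0027 §2.1) of route PneNP/NegLimited, PROVED outright: the thesis alone decides
-- `PneNP`. If every Cook-NP language were Cook-P, transport the thesis language `L` along the model
-- bridges `NP_bool_eq_holds` / `P_bool_eq_holds` into `Classes.P ⊆ PPoly` (`P_subset_PPoly_holds`,
-- Arora–Barak Thm 6.6): `L` has B₂-circuits of size `≤ p(n)`; convert them to the De Morgan basis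
-- (`Circuit.exists_deMorgan_of_B2`, size `≤ 12 s + 3`, needs `0 < n`) and apply Fischer's theorem
-- (`fischer_negationLimited_holds.exists_le_pow`: `≤ ⌈log₂(n+1)⌉` NOT gates, size `≤ 2 s + c (n⁴ + 1)`);
-- the resulting polynomial bound is eventually `≤ n ^ (max k 4 + 1)`, contradicting the thesis at that
-- exponent on one of its infinitely many lengths `n`.
@[closes "route-PneNP-NegLimited"] theorem closes (hX : NeglimitedThesis) : _root_.PneNP := by
  classical
  by_contra hne
  unfold PneNP Literature.PNP.PNeNP at hne
  push Not at hne
  obtain ⟨L, hLNP, hL⟩ := hX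
  have hNP : Literature.Computability.Complexity.PNPWave0.NP Bool =
      Literature.Computability.Complexity.Nondeterministic.NP :=
    Literature.Computability.Complexity.NP_bool_eq_holds
  have hP : Literature.Computability.Complexity.PNPWave0.P Bool =
      Literature.Computability.Complexity.Classes.P :=
    Literature.Computability.Complexity.P_bool_eq_holds
  have hLP : L ∈ Literature.Computability.Complexity.Classes.P := by
    rw [← hP]
    exact hne L (by rw [hNP]; exact hLNP)
  have hLPP : L ∈ Literature.Computability.Complexity.PPoly :=
    Literature.Computability.Complexity.P_subset_PPoly_holds hLP
  simp only [Literature.Computability.Complexity.PPoly, Set.mem_iUnion] at hLPP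
  obtain ⟨p, Cf, hCf, hdec⟩ := hLPP
  obtain ⟨cF, hF⟩ := Literature.Computability.Complexity.fischer_negationLimited_holds.exists_le_pow
  obtain ⟨c, k, hpk⟩ := Literature.Computability.Complexity.exists_eval_le_mul_pow_add p
  -- the polynomial size bound is eventually below `n ^ (max k 4 + 1)`
  have key : ∀ n : ℕ, 48 * c + 6 + 2 * cF ≤ n → 1 ≤ n →
      2 * (12 * (c * n ^ k + c) + 3) + cF * (n ^ 4 + 1) ≤ n ^ (max k 4 + 1) := by
    intro n hS hn1
    have h1 : n ^ k ≤ n ^ max k 4 := Nat.pow_le_pow_right hn1 (le_max_left k 4)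
    have h2 : n ^ 4 ≤ n ^ max k 4 := Nat.pow_le_pow_right hn1 (le_max_right k 4)
    have h3 : 1 ≤ n ^ max k 4 := Nat.one_le_pow _ _ hn1
    have e1 := Nat.mul_le_mul_left c h1
    have e2 := Nat.mul_le_mul_left c h3
    have e3 := Nat.mul_le_mul_left cF h2
    have e4 := Nat.mul_le_mul_left cF h3
    have e5 : (48 * c + 6 + 2 * cF) * n ^ max k 4 ≤ n * n ^ max k 4 := Nat.mul_le_mul_right _ hS
    calc 2 * (12 * (c * n ^ k + c) + 3) + cF * (n ^ 4 + 1)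
        ≤ (48 * c + 6 + 2 * cF) * n ^ max k 4 := by nlinarith [e1, e2, e3, e4, h3]
      _ ≤ n * n ^ max k 4 := e5
      _ = n ^ (max k 4 + 1) := (pow_succ' n (max k 4)).symm
  have hev : ∀ᶠ n : ℕ in Filter.atTop, 48 * c + 6 + 2 * cF ≤ n ∧ 1 ≤ n :=
    (Filter.eventually_ge_atTop _).and (Filter.eventually_ge_atTop 1)
  obtain ⟨n, hAll, hSn, hn1⟩ := ((hL (max k 4 + 1)).and_eventually hev).exists
  -- at this length: a B₂-circuit of size ≤ p n for the slice, converted and negation-limited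
  have hcomp : (Cf n).Computes (L.sliceFn n) := fun x => hdec.eval_eq x
  obtain ⟨C₁, hB₁, hC₁, hs₁⟩ :=
    Literature.Computability.Complexity.Circuit.exists_deMorgan_of_B2 (Cf n) (hCf n).1 ⟨0, hn1⟩ hcomp
  obtain ⟨C₂, hB₂, hC₂, hneg₂, hs₂⟩ := hF (L.sliceFn n) C₁ hB₁ hC₁
  have hw : (fun g : Literature.Computability.Complexity.GateFn =>
      if g = Literature.Computability.Complexity.GateFn.not then 1 else 0) =
      Literature.Computability.Complexity.negWeight := by
    funext g
    unfold Literature.Computability.Complexity.negWeight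
    congr 1
  have hneg' : C₂.sizeWith (fun g => if g = Literature.Computability.Complexity.GateFn.not then 1 else 0)
      ≤ Nat.clog 2 (n + 1) := by
    rw [hw]
    exact hneg₂
  have hlt : n ^ (max k 4 + 1) < C₂.size := hAll C₂ hB₂ hC₂ hneg'
  have hle : C₂.size ≤ n ^ (max k 4 + 1) :=
    calc C₂.size ≤ 2 * C₁.size + cF * (n ^ 4 + 1) := hs₂
      _ ≤ 2 * (12 * (Cf n).size + 3) + cF * (n ^ 4 + 1) := by gcongr
      _ ≤ 2 * (12 * p.eval n + 3) + cF * (n ^ 4 + 1) := by gcongr; exact (hCf n).2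
      _ ≤ 2 * (12 * (c * n ^ k + c) + 3) + cF * (n ^ 4 + 1) := by gcongr; exact hpk n
      _ ≤ n ^ (max k 4 + 1) := key n hSn hn1
  exact absurd hlt (not_lt.2 hle)

end Summit.PneNP.PneNP.Theses.NegLimited
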